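import Literature.MathematicalPhysics.QuantumFieldTheory.Balaban1983to89.B6Cor28GradEntryKLevelV1L0
import Literature.MathematicalPhysics.QuantumFieldTheory.Balaban1983to89.B6Cor28KLevelV1L3
import Literature.MathematicalPhysics.QuantumFieldTheory.Balaban1983to89.B6Prop26GradKLevelV1L3
import HarnessLib

/-!
# `Balaban1983to89.B6Cor28GradEntryKLevelV1L3` — SUB-ROW G-F3′-L0∕L3 (every odd `L ≥ 3`; plan `lit-balaban-r03/G-F3L0-PLAN.md` §13 cure (B′), joints J9′–J14): the L = 3 twin of
`B6Cor28GradEntryKLevelV1L0` — ONLY its window-dependent assembly theorem is re-declared (joint J14: every window-free declaration of the level-0 twin is consumed BY NAME),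
re-proved verbatim over the L3 parents (canonical chart `B6CubeWindowV1L3`, placement predicate `PlacedC`, the binder `4 ≤ ℓ` DROPPED, `R ≥ 2L²` KEPT).
T. Bałaban, *Propagators and renormalization transformations for lattice gauge theories. II*, Commun. Math. Phys. **96** (1984) 223–250 [Balaban1984PropagatorsII].
No `def … : Prop`, no new fact; standard axioms.  Unit `lit-balaban-r03` (B6 fold owner, r03 gen 37), 2026-08-27; referee ref-4.  NOT summit progress.

statement-level skeleton of published theorems with citation tags; proofs where landed; nothing here is a claim about the Yang–Mills mass gap
-/

namespace Literature.MathematicalPhysics.QuantumFieldTheory.Balaban1983to89.B6Cor28GradEntryKLevelV1L3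

open scoped InnerProductSpace
open LatticeFieldCalculus
open B6SectAOperatorsV1 (QE QsE BondIdx BondIdxSpace)
open B6SectAVectorModelV1 (GE EE)
open B6Ineq2133TwoScaleV1 (onFun onFun_apply)
open B6RandomWalk (HasMajorant delta3)
open B6MultiLevelBoxOperator (N0)
open B6MultiLevelTorusOperatorL0 (TDomains)
open B6GlobalChartV1 (PV)
open B6GlobalChartV1L0 (domT blkV1)
open B6Geom246MultiLevelBoxL0 (bset)
open B6Geom246MultiLevelTorusL0 (geomT lemma21_torus)
open B8Ineq192MultiLevelTorusL0 (lenT_eq lenT_pos)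
open B6Ineq261LevelGap (K261 K261_nonneg)
open B6Lemma21Repaired (Ineq263With)
open B6Prop26KLevelSkeletonV1L0 (pref pref_nonneg)
open B6Ineq2142KLevelV1L0 (lvl β qwt)
open B6Prop27KLevelV1L0 (lam card_fiber_beta_le)
open B6Prop26GradKLevelV1L3 (prop26_2136_grad_kLevel_unconditional)
open B6GradLegKLevelV1 (DV)
open B6Cor28KLevelV1 (two_le_RMh absorb_threshold theta_threshold)
open B6Cor28KLevelV1L0 (comp_entry_le H_entry_le pref_pos)
open B6CubeWindowV1 (Placed GlobalBand)
open B6Cover236MultiLevelBlocksL0 (cubes)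
open B6CubeWindowV1L3 (PlacedC)
open Literature.MathematicalPhysics.QuantumFieldTheory.Balaban1983to89.B6Cor28GradEntryKLevelV1L0 (DH_entry_le)
open B6Prop27KLevelV1L0 (wt)

noncomputable section

variable {d ℓ m K : ℕ} {hd : 1 ≤ d + 1} {hL : Odd (ℓ + 1) ∧ 1 < ℓ + 1}
variable {Mh k R : ℕ} {P' : Fin (d + 1) → ℕ}

/-- **[B6] COROLLARY 2.8, THE ENTRIES `|H(b, c)|` AND `|(∇H)(b, c)|` OF (2.151), AT k LEVELS FOR THE GENUINE `H = GQ*(QGQ*)⁻¹ = GE ∘ QsE ∘ EE`, MODULO THE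
LEVEL-WEIGHTED (2.147)** (binders of `B6Prop27KLevelV1L0.prop27_kLevel` verbatim — its ONE displayed hypothesis, the coercivity (2.147) `γΣ_iΛ_i²v_i² ≤ ⟪Q*v, GQ*v⟫`
with a free `γ > 0` on which the constants depend — the thresholds `M₂`, `N₁` enlarged), ONE set of constants: for every `σ ∈ (0, σ₁]`, `α ∈ (0, 1)`, `γ > 0`
there are `δ₅ > 0`, `C ≥ 0`, `M₂ > 0`, `N₁` such that for every such torus family, weights in the band and `QGQ*` coercive with `γ`, for EVERY index bond `c`,
fine bond `f` and direction `ν`: `|(He_c)(f)| ≤ C·e^{−δ₅·d_T(y(f), β c)}` and `|(∇_νHe_c)(f)| ≤ C·(L^{j(y(f))}η)^{−1}·e^{−δ₅·d_T(y(f), β c)}` (print: «|H(b,c)|,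
|(∇H)(b,c)| ≤ O(1)[1, (L^jη)^{−1}](L^{j′}η)^{−d}e^{−δ₅d(y,c₋)}» with the (2.150) weight of the flat entries; `(L^jη)^{−1} = (len(y)·|c_f|⁻¹)⁻¹`).  Inputs BY NAME:
p38's k-level (2.136)₁,₂ `B6Prop26GradKLevelV1L0.prop26_2136_grad_kLevel_unconditional` (no displayed hypothesis) and (2.149) modulo (2.147) `B6Prop27KLevelV1L0.prop27_kLevel`;
the discharge of (2.147) (print's `γ₀`) is ROUTE W part W1, after which `γ := γ₀` gives the hypothesis-free form (`B6Cor28EntriesKLevelV1.cor28_kLevel_H_DH`).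
[cite: Balaban1984PropagatorsII, Cor. 2.8 (2.150)–(2.151) p.249, Prop. 2.6 (2.136) p.247, Prop. 2.7 (2.147)–(2.149) p.248–249, Lemma 2.1 (2.60)–(2.63) p.234] -/
theorem cor28_kLevel_H_DH_of_2147 (d ℓ : ℕ) (hd : 1 ≤ d + 1) (hL : Odd (ℓ + 1) ∧ 1 < ℓ + 1) {b₀ b₁ : ℝ} (hb₀ : 0 < b₀) (hb₁ : b₀ ≤ b₁) :
    ∃ σ₁ : ℝ, 0 < σ₁ ∧ ∀ (σ : ℝ), 0 < σ → σ ≤ σ₁ → ∀ (α : ℝ), 0 < α → α < 1 → ∀ (γ : ℝ), 0 < γ →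
    ∃ (δ₅ C M₂ : ℝ) (N₁ : ℕ), 0 < δ₅ ∧ 0 ≤ C ∧ 0 < M₂ ∧
    ∀ (m K : ℕ) {Mh k R : ℕ} {P' : Fin (d + 1) → ℕ}
      (hN : ∀ μ, N0 ℓ Mh k P' μ = (PV d ℓ m K hd hL).sitesPerDir 0) (D : B6MultiLevelTorusOperatorL0.TDomains d ℓ Mh k P' R) (hk : k ≤ m + K) (_ : 2 ≤ k)
      {a : ℕ} (_ : Mh = (ℓ + 1) ^ a) (_ : 8 ≤ Mh) (_ : 2 * (ℓ + 1) ^ 2 ≤ R) (_ : ∀ μ, 5 ≤ P' μ)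
      (_ : ∀ c : ↥(cubes D.toDomains), PlacedC ℓ k P' c.1) (_ : M₂ ≤ ((ℓ : ℝ) + 1) * Mh) (_ : N₁ + 1 ≤ R * ((ℓ + 1) * Mh))
      {cf : ℝ} (hcf : cf ≠ 0) {w : BondIdx (domT hN D hk) → ℝ} (hw : ∀ i, 0 < w i) (_ : GlobalBand b₀ b₁ cf w)
      (_ : ∀ v : BondIdxSpace (domT hN D hk), γ * ∑ i, wt hN D hk cf i * v i ^ 2 ≤
        ⟪QsE (domT hN D hk) v, GE (domT hN D hk) hcf hw (QsE (domT hN D hk) v)⟫_ℝ),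
      (∀ (c : BondIdx (domT hN D hk)) (f : PBond (PV d ℓ m K hd hL) 0),
        |(GE (domT hN D hk) hcf hw ∘ₗ QsE (domT hN D hk) ∘ₗ EE (domT hN D hk) hcf hw) (EuclideanSpace.single c (1 : ℝ)) f| ≤
          C * Real.exp (-(δ₅ * (geomT D).dist (blkV1 hN D f) (β hN D hk c)))) ∧
      (∀ (ν : Fin (d + 1)) (c : BondIdx (domT hN D hk)) (f : PBond (PV d ℓ m K hd hL) 0),
        |(DV ν cf ∘ₗ onFun (GE (domT hN D hk) hcf hw ∘ₗ QsE (domT hN D hk) ∘ₗ EE (domT hN D hk) hcf hw)) (Pi.single c 1) f| ≤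
          C * ((geomT D).len (blkV1 hN D f) * |cf|⁻¹)⁻¹ * Real.exp (-(δ₅ * (geomT D).dist (blkV1 hN D f) (β hN D hk c)))) := by
  obtain ⟨σ₁, hσ₁, h26⟩ := prop26_2136_grad_kLevel_unconditional d ℓ hd hL hb₀ hb₁
  obtain ⟨σ₂, hσ₂, h27⟩ := B6Prop27KLevelV1L3.prop27_kLevel d ℓ hd hL hb₀ hb₁
  refine ⟨min σ₁ σ₂, lt_min hσ₁ hσ₂, fun σ hσ hσ1 α hα hα1 γ hγ0 => ?_⟩
  obtain ⟨A, M₂, hA, hM₂, hG⟩ := h26 σ hσ (hσ1.trans (min_le_left _ _)) α hα hα1.le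
  obtain ⟨A', M₂', c, N₁, hA', hM₂', hc, hEE⟩ := h27 σ hσ (hσ1.trans (min_le_right _ _)) α hα hα1
  clear h26 h27
  -- the rates
  set δ₃ : ℝ := delta3 α (2 * σ) with hδ₃
  have hδ₃pos : 0 < δ₃ := B6RandomWalk.delta3_pos hα1 (by linarith)
  set δ₄ : ℝ := min (δ₃ / 4) (γ / A' / (2 * (1 * (4 / δ₃) * (2 * ((d : ℝ) + 1) * c)) + 1)) with hδ₄
  have hδ₄pos : 0 < δ₄ := by
    rw [hδ₄]
    refine lt_min (by linarith) (div_pos (div_pos hγ0 hA') ?_)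
    have : 0 ≤ 2 * (1 * (4 / δ₃) * (2 * ((d : ℝ) + 1) * c)) := by positivity
    linarith
  have hδ₄le : δ₄ ≤ δ₃ := (min_le_left _ _).trans (by linarith)
  -- the threshold of (2.63) on the torus at rate `δ₄/2`, `α′ = 1/16`
  obtain ⟨hN₂pos, hθ⟩ := theta_threshold d ℓ hδ₄pos
  set N₂ : ℕ := ⌈64 * ((d : ℝ) + 1) * ((ℓ : ℝ) + 1) / δ₄⌉₊ + 1 with hN₂
  set c63 : ℝ := K261 N₂ (d + 1) ((ℓ : ℝ) + 1) 1 (1 / 16 * (δ₄ / 2)) with hc63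
  -- the absorption threshold `N₃ ≥ 2(d+3)L/δ₄`
  obtain ⟨N₃, hN₃⟩ : ∃ N₃ : ℕ, N₃ = ⌈2 * ((d : ℝ) + 3) * ((ℓ : ℝ) + 1) / δ₄⌉₊ + 1 := ⟨_, rfl⟩
  have hN₃ge : 2 * ((d : ℝ) + 3) * ((ℓ : ℝ) + 1) ≤ δ₄ * (N₃ : ℝ) := by
    have h1 : 2 * ((d : ℝ) + 3) * ((ℓ : ℝ) + 1) / δ₄ ≤ (N₃ : ℝ) := by
      rw [hN₃]; push_cast; exact (Nat.le_ceil _).trans (by linarith)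
    rw [div_le_iff₀ hδ₄pos] at h1; linarith
  -- constants
  set C : ℝ := A * (2 / γ * (2 * (((ℓ + 1 : ℕ) : ℝ)) ^ (d + 1) * Real.exp (δ₃ * ((ℓ : ℝ) + 3))) * ((ℓ : ℝ) + 1) ^ 2 *
    ((ℓ : ℝ) + 1) ^ (d + 3) * (2 * ((d : ℝ) + 1)) * c63 ^ 2) with hC
  have hc63_0 : 0 ≤ c63 := K261_nonneg (by positivity) zero_le_one
  have hC0 : 0 ≤ C := by positivity
  refine ⟨(1 - 1 / 16) * (δ₄ / 2), C, max M₂ M₂', max (max N₁ N₂) N₃, by positivity, hC0, lt_max_of_lt_left hM₂, ?_⟩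
  intro m K Mh k R P' hN D hk hk2 a hMha hM8 hR2 hP5 hpl hM hRM cf hcf w hw hwb hγ
  have hMh : 1 ≤ Mh := le_trans (by norm_num) hM8
  have hP : ∀ μ, 1 ≤ P' μ := fun μ => le_trans (by norm_num) (hP5 μ)
  have hRM2 : 2 ≤ R * Mh := two_le_RMh hR2 hM8
  -- the two inputs
  obtain ⟨hT, hTD⟩ := hG m K hN D hk hk2 hMha hM8 hR2 hP5 hpl ((le_max_left _ _).trans hM) hcf hw hwb
  have h2149 := hEE m K hN D hk hk2 hMha hM8 hR2 hP5 hpl ((le_max_right _ _).trans hM)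
    (le_trans (Nat.succ_le_succ ((le_max_left _ _).trans (le_max_left _ _))) hRM) hcf hw hwb hγ0 hγ
  clear hG hEE
  -- (2.63) on the torus at rate `δ₄/2`, `α′ = 1/16`
  have hRM2' : N₂ + 1 ≤ R * ((ℓ + 1) * Mh) := le_trans (Nat.succ_le_succ ((le_max_right _ _).trans (le_max_left _ _))) hRM
  obtain ⟨-, -, -, h263⟩ := lemma21_torus D hMh hP hN₂pos hRM2' (δ₀ := δ₄ / 2) (α := 1 / 16) (by positivity) (by norm_num) (by norm_num) hθ
  -- the absorption threshold
  have hN₃le : (N₃ : ℝ) ≤ (R : ℝ) * (((ℓ : ℝ) + 1) * Mh) - 1 := by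
    have h1 : N₃ + 1 ≤ R * ((ℓ + 1) * Mh) := le_trans (Nat.succ_le_succ (le_max_right _ _)) hRM
    have h2 : ((N₃ + 1 : ℕ) : ℝ) ≤ ((R * ((ℓ + 1) * Mh) : ℕ) : ℝ) := by exact_mod_cast h1
    push_cast at h2; linarith
  have hsmall : ((ℓ : ℝ) + 1) ^ (d + 3) * Real.exp (-(δ₄ / 2 * ((R : ℝ) * (((ℓ : ℝ) + 1) * Mh) - 1))) ≤ 1 :=
    absorb_threshold hδ₄pos hN₃ge hN₃le
  refine ⟨fun c' f => ?_, fun ν c' f => ?_⟩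
  · have h := H_entry_le hN D hk hcf hw hRM2 hMh hP hA (by positivity : (0 : ℝ) ≤ 2 / γ) hδ₄pos hδ₄le
      hT (fun x x' => h2149 x x') hsmall h263 c' f
    rw [hC]
    exact h
  · have h := DH_entry_le hN D hk hcf hw hRM2 hMh hP hA (by positivity : (0 : ℝ) ≤ 2 / γ) hδ₄pos hδ₄le ν
      (hTD ν) (fun x x' => h2149 x x') hsmall h263 c' f
    rw [hC]
    calc _ ≤ _ := h
      _ = _ := by ring


end

end Literature.MathematicalPhysics.QuantumFieldTheory.Balaban1983to89.B6Cor28GradEntryKLevelV1L3
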